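import Summits.AtomisticToContinuum.FouriersLaw.Theorems.BondHeatUncertaintySubdiffusiveBondHeatFejerKernel

/-!
# Spectral representation of the once-integrated tail of an integrable kernel, and the Warburg-to-EW bound

Real-analysis lemmas for the spectral transfer `ContactWarburgModulus ⟹ TransientEW` (crux `stmt-AtomisticToContinuum-9120`,
line `bath-bond-deficit-integral`, lead c5).  For a measurable kernel `K ∈ L¹(0,∞)` (the boundary kernel `K_N` of route
`BoundaryEscapeDeficit` is such a kernel for every `N ≥ 1`), with `c₁ = ∫_{(0,∞)} (1 − cos ω)/ω²`,
`c₂ = ∫_{(0,∞)} (1 − cos v)/(v√v)` (`FejerKernel`) and the DIP `D_K(ω) := ∫_{(0,∞)} (1 − cos ωu) K(u) du`: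

* `intervalIntegral_integral_Ioi_eq_integral_min_mul` — `∫₀ᵗ ∫_{(s,∞)} K = ∫_{(0,∞)} min(u,t) K(u) du` (Fubini);
* `integral_min_mul_eq_spectral` — `c₁ ∫_{(0,∞)} min(u,t) K(u) du = ∫_{(0,∞)} (1 − cos ωt) ω⁻² D_K(ω) dω` (spectral
  representation of `min` + Fubini), whence `transientTail_eq_spectral`:
  **`c₁ ∫₀ᵗ ∫_{(s,∞)} K = ∫_{(0,∞)} (1 − cos ωt) ω⁻² D_K(ω) dω`**;
* `transientTail_le_sqrt_of_warburg` — **Warburg ⟹ Edwards–Wilkinson**: if `a·D_K(ω) ≤ C√ω` on `(0,1]` and `a·D_K(ω) ≤ 1`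
  on `(0,∞)` (`a > 0`), then `a ∫₀ᵗ ∫_{(s,∞)} K ≤ ((max C 0)·c₂ + 2)/c₁ · √t` for every `t ≥ 1`.
-/

noncomputable section

open MeasureTheory Set Filter Topology

namespace Summit.AtomisticToContinuum.FouriersLaw.Theorems.SubdiffusiveBondHeat

/-! ### `∫₀ᵗ ∫_{(s,∞)} K = ∫_{(0,∞)} min(u,t) K(u) du` -/

/-- **Once-integrated tail = `min`-weighted integral**: for `K` measurable and integrable on `(0,∞)` and `t ≥ 0`,
`∫₀ᵗ (∫_{(s,∞)} K(u) du) ds = ∫_{(0,∞)} min(u,t) K(u) du`. [folklore] -/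
theorem intervalIntegral_integral_Ioi_eq_integral_min_mul {K : ℝ → ℝ} (hKm : Measurable K)
    (hKi : IntegrableOn K (Ioi 0)) {t : ℝ} (ht : 0 ≤ t) :
    ∫ s in (0 : ℝ)..t, (∫ u in Ioi s, K u) = ∫ u in Ioi 0, min u t * K u := by
  rw [intervalIntegral.integral_of_le ht]
  haveI : IsFiniteMeasure ((volume : Measure ℝ).restrict (Ioc 0 t)) := by
    refine ⟨?_⟩
    rw [Measure.restrict_apply_univ]
    exact measure_Ioc_lt_top
  -- the integrand on the product
  set F : ℝ × ℝ → ℝ := fun p => if p.1 < p.2 then K p.2 else 0 with hF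
  have hFm : Measurable F :=
    Measurable.ite (measurableSet_lt measurable_fst measurable_snd) (hKm.comp measurable_snd) measurable_const
  have hGi : Integrable (fun p : ℝ × ℝ => (1 : ℝ) * K p.2)
      (((volume : Measure ℝ).restrict (Ioc 0 t)).prod ((volume : Measure ℝ).restrict (Ioi 0))) :=
    (integrable_const (1 : ℝ)).mul_prod hKi
  have hFi : Integrable F (((volume : Measure ℝ).restrict (Ioc 0 t)).prod ((volume : Measure ℝ).restrict (Ioi 0))) := by
    refine hGi.norm.mono' hFm.aestronglyMeasurable (Eventually.of_forall fun p => ?_)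
    simp only [hF, one_mul]
    split_ifs
    · exact le_rfl
    · simp
  -- the inner integral on the left
  have hinner : ∀ s ∈ Ioc (0 : ℝ) t, ∫ u in Ioi s, K u = ∫ u in Ioi 0, F (s, u) := by
    intro s hs
    have h1 : (fun u => F (s, u)) = (Ioi s).indicator K := by
      ext u
      simp only [hF, Set.indicator, mem_Ioi]
    rw [h1, setIntegral_indicator measurableSet_Ioi, Ioi_inter_Ioi, max_eq_right hs.1.le]
  rw [setIntegral_congr_fun measurableSet_Ioc hinner]
  -- Fubini
  have hswap := integral_integral_swap (μ := (volume : Measure ℝ).restrict (Ioc 0 t))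
    (ν := (volume : Measure ℝ).restrict (Ioi 0)) (f := fun s u => F (s, u))
    (by exact hFi)
  rw [hswap]
  refine setIntegral_congr_fun measurableSet_Ioi fun u hu => ?_
  have hu0 : (0 : ℝ) < u := hu
  -- the inner integral on the right
  have h2 : (fun s => F (s, u)) = (Iio u).indicator (fun _ => K u) := by
    ext s
    simp only [hF, Set.indicator, mem_Iio]
  rw [h2, setIntegral_indicator measurableSet_Iio, setIntegral_const, smul_eq_mul]
  congr 1
  rcases le_or_gt u t with hut | htu
  · have hset : Ioc (0 : ℝ) t ∩ Iio u = Ioo 0 u := by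
      ext s
      simp only [mem_inter_iff, mem_Ioc, mem_Iio, mem_Ioo]
      constructor
      · rintro ⟨⟨h1, -⟩, h3⟩; exact ⟨h1, h3⟩
      · rintro ⟨h1, h3⟩; exact ⟨⟨h1, h3.le.trans hut⟩, h3⟩
    rw [hset, Real.volume_real_Ioo_of_le hu0.le, min_eq_left hut, sub_zero]
  · have hset : Ioc (0 : ℝ) t ∩ Iio u = Ioc 0 t := by
      ext s
      simp only [mem_inter_iff, mem_Ioc, mem_Iio]
      constructor
      · rintro ⟨h, -⟩; exact h
      · rintro ⟨h1, h2⟩; exact ⟨⟨h1, h2⟩, h2.trans_lt htu⟩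
    rw [hset, Real.volume_real_Ioc_of_le ht, min_eq_right htu.le, sub_zero]

/-! ### The spectral representation -/

/-- The double integrand `(u, ω) ↦ (1 − cos ωt)(1 − cos ωu) ω⁻² K(u)` is integrable on `(0,∞)²` (dominated by
`|K(u)|·2(1 − cos ωt)/ω²`). [folklore] -/
theorem integrable_spectralDouble {K : ℝ → ℝ} (hKm : Measurable K) (hKi : IntegrableOn K (Ioi 0))
    {t : ℝ} (ht : 0 ≤ t) :
    Integrable (fun p : ℝ × ℝ => (1 - Real.cos (p.2 * t)) * (1 - Real.cos (p.2 * p.1)) / p.2 ^ 2 * K p.1)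
      (((volume : Measure ℝ).restrict (Ioi 0)).prod ((volume : Measure ℝ).restrict (Ioi 0))) := by
  have hGm : Measurable fun p : ℝ × ℝ => (1 - Real.cos (p.2 * t)) * (1 - Real.cos (p.2 * p.1)) / p.2 ^ 2 * K p.1 := by
    have : Measurable fun p : ℝ × ℝ => (1 - Real.cos (p.2 * t)) * (1 - Real.cos (p.2 * p.1)) / p.2 ^ 2 := by fun_prop
    exact this.mul (hKm.comp measurable_fst)
  have hDi : Integrable (fun p : ℝ × ℝ => K p.1 * (2 * ((1 - Real.cos (p.2 * t)) / p.2 ^ 2)))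
      (((volume : Measure ℝ).restrict (Ioi 0)).prod ((volume : Measure ℝ).restrict (Ioi 0))) :=
    hKi.mul_prod ((integrableOn_one_sub_cos_mul_div_sq ht).const_mul 2)
  refine hDi.norm.mono' hGm.aestronglyMeasurable (Eventually.of_forall fun p => ?_)
  have h1 := one_sub_cos_mem_Icc (p.2 * t)
  have h2 := one_sub_cos_mem_Icc (p.2 * p.1)
  have hq : 0 ≤ (1 - Real.cos (p.2 * t)) * (1 - Real.cos (p.2 * p.1)) / p.2 ^ 2 :=
    div_nonneg (mul_nonneg h1.1 h2.1) (sq_nonneg _)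
  have hb : (1 - Real.cos (p.2 * t)) * (1 - Real.cos (p.2 * p.1)) / p.2 ^ 2 ≤ 2 * ((1 - Real.cos (p.2 * t)) / p.2 ^ 2) := by
    rw [mul_div_assoc']
    refine div_le_div_of_nonneg_right ?_ (sq_nonneg _)
    nlinarith [h1.1, h1.2, h2.1, h2.2]
  have h2' : 0 ≤ 2 * ((1 - Real.cos (p.2 * t)) / p.2 ^ 2) := mul_nonneg zero_le_two (div_nonneg h1.1 (sq_nonneg _))
  rw [Real.norm_eq_abs, Real.norm_eq_abs, abs_mul, abs_of_nonneg hq, abs_mul, abs_of_nonneg h2', mul_comm]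
  exact mul_le_mul_of_nonneg_left hb (abs_nonneg _)

/-- The spectral integrand `ω ↦ (1 − cos ωt) ω⁻² D_K(ω)` is integrable on `(0,∞)`. [folklore] -/
theorem integrableOn_spectralIntegrand {K : ℝ → ℝ} (hKm : Measurable K) (hKi : IntegrableOn K (Ioi 0))
    {t : ℝ} (ht : 0 ≤ t) :
    IntegrableOn (fun ω : ℝ => (1 - Real.cos (ω * t)) / ω ^ 2 * ∫ u in Ioi 0, (1 - Real.cos (ω * u)) * K u) (Ioi 0) := by
  have h := (integrable_spectralDouble hKm hKi ht).swap.integral_prod_left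
  refine h.congr (Eventually.of_forall fun ω => ?_)
  simp only [Function.comp_apply, Prod.swap_prod_mk]
  rw [← integral_const_mul]
  refine integral_congr_ae (Eventually.of_forall fun u => ?_)
  ring

/-- **`c₁ ∫_{(0,∞)} min(u,t) K(u) du = ∫_{(0,∞)} (1 − cos ωt) ω⁻² (∫_{(0,∞)} (1 − cos ωu) K(u) du) dω`** for `K` measurable and
integrable on `(0,∞)`, `t ≥ 0`. [folklore] -/
theorem integral_min_mul_eq_spectral {K : ℝ → ℝ} (hKm : Measurable K) (hKi : IntegrableOn K (Ioi 0))
    {t : ℝ} (ht : 0 ≤ t) :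
    (∫ ω in Ioi (0 : ℝ), (1 - Real.cos ω) / ω ^ 2) * ∫ u in Ioi 0, min u t * K u =
      ∫ ω in Ioi (0 : ℝ), (1 - Real.cos (ω * t)) / ω ^ 2 * ∫ u in Ioi 0, (1 - Real.cos (ω * u)) * K u := by
  set c₁ : ℝ := ∫ ω in Ioi (0 : ℝ), (1 - Real.cos ω) / ω ^ 2 with hc₁
  -- Step 1: insert the spectral representation of `min`
  have hmin : ∀ u ∈ Ioi (0 : ℝ), c₁ * (min u t * K u) =
      ∫ ω in Ioi (0 : ℝ), (1 - Real.cos (ω * t)) * (1 - Real.cos (ω * u)) / ω ^ 2 * K u := by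
    intro u hu
    rw [integral_mul_const, integral_one_sub_cos_mul_one_sub_cos_div_sq (le_of_lt hu) ht]
    ring
  rw [← integral_const_mul, setIntegral_congr_fun measurableSet_Ioi hmin]
  -- Step 2: Fubini on `(0,∞) × (0,∞)`
  have hGi := integrable_spectralDouble hKm hKi ht
  have hswap := integral_integral_swap (μ := (volume : Measure ℝ).restrict (Ioi 0))
    (ν := (volume : Measure ℝ).restrict (Ioi 0))
    (f := fun u ω => (1 - Real.cos (ω * t)) * (1 - Real.cos (ω * u)) / ω ^ 2 * K u)
    (by exact hGi)
  rw [hswap]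
  refine setIntegral_congr_fun measurableSet_Ioi fun ω _ => ?_
  rw [← integral_const_mul]
  refine integral_congr_ae (Eventually.of_forall fun u => ?_)
  ring

/-- **Spectral representation of the once-integrated tail**: for `K` measurable and integrable on `(0,∞)` and `t ≥ 0`,
`c₁ · ∫₀ᵗ (∫_{(s,∞)} K) ds = ∫_{(0,∞)} (1 − cos ωt) ω⁻² D_K(ω) dω`, `D_K(ω) = ∫_{(0,∞)} (1 − cos ωu) K(u) du`.
For the boundary kernel this is the strategist's identity `W_N(t) − tE_N = (γ/2πT²)∫(s_N(0) − s_N(ω))(1 − cos ωt)ω⁻² dω`.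
[folklore] -/
theorem transientTail_eq_spectral {K : ℝ → ℝ} (hKm : Measurable K) (hKi : IntegrableOn K (Ioi 0))
    {t : ℝ} (ht : 0 ≤ t) :
    (∫ ω in Ioi (0 : ℝ), (1 - Real.cos ω) / ω ^ 2) * ∫ s in (0 : ℝ)..t, (∫ u in Ioi s, K u) =
      ∫ ω in Ioi (0 : ℝ), (1 - Real.cos (ω * t)) / ω ^ 2 * ∫ u in Ioi 0, (1 - Real.cos (ω * u)) * K u := by
  rw [intervalIntegral_integral_Ioi_eq_integral_min_mul hKm hKi ht, integral_min_mul_eq_spectral hKm hKi ht]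

/-! ### Warburg ⟹ Edwards–Wilkinson -/

/-- **The Warburg-to-Edwards–Wilkinson bound.**  Let `K` be measurable and integrable on `(0,∞)`, `a > 0`, and suppose the
scaled dip `a·D_K(ω) = a∫_{(0,∞)}(1 − cos ωu)K(u)du` (any real `a`) satisfies the WARBURG CUSP bound `a·D_K(ω) ≤ C√ω` for
`0 < ω ≤ 1` and the CEILING `a·D_K(ω) ≤ 1` for all `ω > 0`.  Then for every `t ≥ 1`,
`a ∫₀ᵗ (∫_{(s,∞)} K) ds ≤ ((max C 0)·c₂ + 2)/c₁ · √t`. [folklore] -/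
theorem transientTail_le_sqrt_of_warburg {K : ℝ → ℝ} (hKm : Measurable K) (hKi : IntegrableOn K (Ioi 0))
    {a C : ℝ}
    (hW : ∀ ω : ℝ, 0 < ω → ω ≤ 1 → a * ∫ u in Ioi 0, (1 - Real.cos (ω * u)) * K u ≤ C * Real.sqrt ω)
    (hP : ∀ ω : ℝ, 0 < ω → a * ∫ u in Ioi 0, (1 - Real.cos (ω * u)) * K u ≤ 1)
    {t : ℝ} (ht : 1 ≤ t) :
    a * ∫ s in (0 : ℝ)..t, (∫ u in Ioi s, K u) ≤
      ((max C 0) * (∫ v in Ioi (0 : ℝ), (1 - Real.cos v) / (v * Real.sqrt v)) + 2) /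
        (∫ ω in Ioi (0 : ℝ), (1 - Real.cos ω) / ω ^ 2) * Real.sqrt t := by
  set c₁ : ℝ := ∫ ω in Ioi (0 : ℝ), (1 - Real.cos ω) / ω ^ 2 with hc₁
  set c₂ : ℝ := ∫ v in Ioi (0 : ℝ), (1 - Real.cos v) / (v * Real.sqrt v) with hc₂
  set C' : ℝ := max C 0 with hC'
  have ht0 : 0 < t := lt_of_lt_of_le one_pos ht
  have hc₁ : 0 < c₁ := integral_one_sub_cos_div_sq_pos
  have hc₂ : 0 ≤ c₂ := integral_one_sub_cos_div_mul_sqrt_nonneg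
  have hC'0 : 0 ≤ C' := le_max_right _ _
  set D : ℝ → ℝ := fun ω => ∫ u in Ioi 0, (1 - Real.cos (ω * u)) * K u with hD
  -- the spectral identity, scaled by `a`
  have hid := transientTail_eq_spectral hKm hKi ht0.le
  -- pointwise bound of the spectral integrand on `(0,∞)`
  set b : ℝ → ℝ := fun ω => C' * ((1 - Real.cos (ω * t)) / (ω * Real.sqrt ω)) +
    2 * (Ioi (1 : ℝ)).indicator (fun ω => 1 / ω ^ 2) ω with hb
  have hpt : ∀ ω ∈ Ioi (0 : ℝ), a * ((1 - Real.cos (ω * t)) / ω ^ 2 * D ω) ≤ b ω := by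
    intro ω hω
    have hω : (0 : ℝ) < ω := hω
    have hsω : 0 < Real.sqrt ω := Real.sqrt_pos.2 hω
    have h1 := one_sub_cos_mem_Icc (ω * t)
    have hq : 0 ≤ (1 - Real.cos (ω * t)) / ω ^ 2 := div_nonneg h1.1 (sq_nonneg _)
    have hfirst : 0 ≤ C' * ((1 - Real.cos (ω * t)) / (ω * Real.sqrt ω)) :=
      mul_nonneg hC'0 (div_nonneg h1.1 (mul_nonneg hω.le hsω.le))
    have hsecond : 0 ≤ 2 * (Ioi (1 : ℝ)).indicator (fun ω => 1 / ω ^ 2) ω := by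
      refine mul_nonneg zero_le_two (Set.indicator_nonneg (fun x _ => ?_) _)
      positivity
    rw [show a * ((1 - Real.cos (ω * t)) / ω ^ 2 * D ω) = (1 - Real.cos (ω * t)) / ω ^ 2 * (a * D ω) by ring]
    rcases le_or_gt ω 1 with hω1 | hω1
    · -- Warburg branch
      have hw : a * D ω ≤ C' * Real.sqrt ω := (hW ω hω hω1).trans (mul_le_mul_of_nonneg_right (le_max_left _ _) hsω.le)
      calc (1 - Real.cos (ω * t)) / ω ^ 2 * (a * D ω) ≤ (1 - Real.cos (ω * t)) / ω ^ 2 * (C' * Real.sqrt ω) :=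
            mul_le_mul_of_nonneg_left hw hq
        _ = C' * ((1 - Real.cos (ω * t)) / (ω * Real.sqrt ω)) := by
            have hω2 : ω ^ 2 = ω * Real.sqrt ω * Real.sqrt ω := by
              rw [mul_assoc, Real.mul_self_sqrt hω.le]; ring
            rw [hω2]
            field_simp
        _ ≤ b ω := by rw [hb]; linarith
    · -- ceiling branch
      have hind : (Ioi (1 : ℝ)).indicator (fun ω => 1 / ω ^ 2) ω = 1 / ω ^ 2 := by
        rw [Set.indicator_of_mem (show ω ∈ Ioi (1 : ℝ) from hω1)]
      calc (1 - Real.cos (ω * t)) / ω ^ 2 * (a * D ω) ≤ (1 - Real.cos (ω * t)) / ω ^ 2 * 1 :=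
            mul_le_mul_of_nonneg_left (hP ω hω) hq
        _ ≤ 2 / ω ^ 2 := by rw [mul_one]; exact div_le_div_of_nonneg_right h1.2 (sq_nonneg _)
        _ = 2 * (Ioi (1 : ℝ)).indicator (fun ω => 1 / ω ^ 2) ω := by rw [hind]; ring
        _ ≤ b ω := by rw [hb]; linarith
  -- integrability of `b` and its integral
  have hbi1 : IntegrableOn (fun ω : ℝ => C' * ((1 - Real.cos (ω * t)) / (ω * Real.sqrt ω))) (Ioi 0) :=
    (integrableOn_one_sub_cos_mul_div_mul_sqrt ht0).const_mul _
  have hbi2 : IntegrableOn (fun ω : ℝ => 2 * (Ioi (1 : ℝ)).indicator (fun ω => 1 / ω ^ 2) ω) (Ioi 0) := by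
    refine Integrable.const_mul ?_ _
    exact (integrableOn_Ioi_one_div_sq.integrable_indicator measurableSet_Ioi).integrableOn
  have hbi : IntegrableOn b (Ioi 0) := hbi1.add hbi2
  have hbint : ∫ ω in Ioi 0, b ω = C' * (Real.sqrt t * c₂) + 2 * 1 := by
    simp only [hb]
    rw [integral_add hbi1 hbi2, integral_const_mul, integral_const_mul, integral_one_sub_cos_mul_div_mul_sqrt ht0,
      integral_indicator measurableSet_Ioi, Measure.restrict_restrict measurableSet_Ioi,
      Ioi_inter_Ioi, max_eq_left zero_le_one, integral_Ioi_one_div_sq]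
  -- compare the integrals
  have hmono : ∫ ω in Ioi 0, a * ((1 - Real.cos (ω * t)) / ω ^ 2 * D ω) ≤ ∫ ω in Ioi 0, b ω :=
    setIntegral_mono_on ((integrableOn_spectralIntegrand hKm hKi ht0.le).const_mul a) hbi measurableSet_Ioi hpt
  rw [integral_const_mul, hbint] at hmono
  -- conclude
  have hfinal : c₁ * (a * ∫ s in (0 : ℝ)..t, (∫ u in Ioi s, K u)) ≤ (C' * c₂ + 2) * Real.sqrt t := by
    have hst : 1 ≤ Real.sqrt t := by rw [← Real.sqrt_one]; exact Real.sqrt_le_sqrt ht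
    calc c₁ * (a * ∫ s in (0 : ℝ)..t, (∫ u in Ioi s, K u)) = a * (c₁ * ∫ s in (0 : ℝ)..t, (∫ u in Ioi s, K u)) := by ring
      _ = a * ∫ ω in Ioi (0 : ℝ), (1 - Real.cos (ω * t)) / ω ^ 2 * D ω := by rw [hid]
      _ ≤ C' * (Real.sqrt t * c₂) + 2 * 1 := hmono
      _ ≤ (C' * c₂ + 2) * Real.sqrt t := by nlinarith [mul_nonneg hC'0 hc₂]
  rw [div_mul_eq_mul_div, le_div_iff₀ hc₁]
  linarith

/-- **Warburg ⟹ Edwards–Wilkinson, `∀`-form** (registered sub-goal): for `K` measurable and integrable on `(0,∞)` and reals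
`a, C`, the cusp bound `a·D_K(ω) ≤ C√ω` on `(0,1]` and the ceiling `a·D_K(ω) ≤ 1` on `(0,∞)` give
`a ∫₀ᵗ ∫_{(s,∞)} K ≤ ((max C 0)·c₂ + 2)/c₁ · √t` for every `t ≥ 1`. [folklore] -/
theorem transientTail_le_sqrt_of_warburgCusp_of_ceiling :
    ∀ (K : ℝ → ℝ), Measurable K → MeasureTheory.IntegrableOn K (Set.Ioi 0) → ∀ (a C : ℝ), (∀ ω : ℝ, 0 < ω → ω ≤ 1 → a * ∫ u in Set.Ioi 0, (1 - Real.cos (ω * u)) * K u ≤ C * Real.sqrt ω) → (∀ ω : ℝ, 0 < ω → a * ∫ u in Set.Ioi 0, (1 - Real.cos (ω * u)) * K u ≤ 1) → ∀ t : ℝ, 1 ≤ t → a * ∫ s in (0 : ℝ)..t, (∫ u in Set.Ioi s, K u) ≤ ((max C 0) * (∫ v in Set.Ioi (0 : ℝ), (1 - Real.cos v) / (v * Real.sqrt v)) + 2) / (∫ ω in Set.Ioi (0 : ℝ), (1 - Real.cos ω) / ω ^ 2) * Real.sqrt t :=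
  fun _ hKm hKi _ _ hW hP _ ht => transientTail_le_sqrt_of_warburg hKm hKi hW hP ht

end Summit.AtomisticToContinuum.FouriersLaw.Theorems.SubdiffusiveBondHeat

end
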